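import Summits.Ventures.QEC.Census.CertCoverBatch
import Summits.Ventures.QEC.Census.BB.A1s_n192_k8_4a6ca3c0.CoreDefs
import HarnessLib

set_option Elab.async false
set_option maxRecDepth 200000

/-!
# `[[192,8,16]]` one-level cover certificate of `A1s_n192_k8_4a6ca3c0` — LEVEL-1→0 coset problems 242…268 (deep problems [2] excluded: `ProbDeep*.lean`) as COMPACT data
(`ProbData`: U, f, σ, y₀, allow; qec-type-10 `CertCoverBatch.mkCoset` rebuilds each `CosetProb` in the kernel) + their verdict
`probsOK cov covR hx hx1 D1 lxd 14` (one `decide +kernel`; 27 problems, depths f=0:26 f=1:1 f=2:0 f=3:0, est. 99.0 s).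
qec-search-1 g5 (pattern of search-9 g5 `Probs*`); data from JSON `level10.problems` (sha256 9a88e3f709803792…). Data + decided check; KERNEL.
-/

namespace Summit.Ventures.QEC.Census.A1s_n192_k8_4a6ca3c0

open Matrix Summit.Ventures.QEC.Census Literature.InformationTheory.QuantumCodes

/-- Problems 242…268 (27): `⟨U, f, σ, y₀, allow⟩`. -/
def probs05b : List ProbData := [
    ⟨10290334165179825696276544, 0, 147241044225, 9742330829116452896770, []⟩,
    ⟨10394081039649862959784192, 0, 146567941785, 10313648470680156747360120, []⟩,
    ⟨10582975474875383219774240, 0, 151433331216, 609337461928866038679476, []⟩,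
    ⟨10894797093001543054524416, 0, 155763869699, 10889777110623302122995838, []⟩,
    ⟨11501327045812369957593088, 0, 164282810497, 1827555846889349253701632, [0]⟩,
    ⟨14511988000509831050969408, 0, 207838350081, 4840575524737060396098880, []⟩,
    ⟨19347542399534882678653060, 1, 277092598552, 19342820031363163155857412, [0]⟩,
    ⟨19347549893524594977442052, 0, 277092705880, 4722368171858035507456, []⟩,
    ⟨19347577021952007396392960, 0, 277143425024, 4647996295858882462, []⟩,
    ⟨19347618563288152898799488, 0, 277093687296, 19347609267295435754571678, []⟩,
    ⟨19357277686188824162992136, 0, 277230911507, 19352257847925711446214558, []⟩,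
    ⟨19359355808047317301364992, 0, 277227185731, 19345188708594446684391424, []⟩,
    ⟨19423242090057348698604416, 0, 278168338833, 19342813114959972154738654, []⟩,
    ⟨24183388792819444493590912, 0, 346350995841, 4840575524737060396074368, []⟩,
    ⟨29019091927162739025257344, 0, 415607341457, 19347685360112540967765920, []⟩,
    ⟨33854794196814938924646848, 0, 484863641601, 29019090908223256760681536, []⟩,
    ⟨38709321147011798455549980, 0, 554387513417, 38690422381129507968913184, []⟩,
    ⟨38992663204083329358889498, 0, 549857668120, 38690422381129505703988484, []⟩,
    ⟨39294840544857564985757696, 0, 562641125504, 609185494152091101889024, []⟩,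
    ⟨39294894660693430768763400, 0, 562641906737, 604472279563940248162108, []⟩,
    ⟨43526208824182607649497088, 0, 623376485505, 4840582442266015022711296, []⟩,
    ⟨77678234173708010791698464, 0, 1112497586305, 77673511805536293433114660, []⟩,
    ⟨77831849352403832023285768, 0, 1114613235729, 77371252455512190211850265, []⟩,
    ⟨77980465619604470994894848, 0, 1099512020992, 65536, [0]⟩,
    ⟨77982965224920825823495220, 0, 1099513747507, 611712768458663416299586, []⟩,
    ⟨77982965246348108287181904, 0, 1099513747811, 611712786473061489573982, []⟩,
    ⟨78587428138141028693574672, 0, 1125484877921, 1216175678265977567445022, []⟩]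

set_option maxHeartbeats 400000000 in
/-- Every problem of this chunk passes (`mkCoset` elimination + `cosetOKD` + fast `σ` + depth + `BU`-evenness + label checks). -/
theorem probs05b_ok : probsOK A1s_n192_k8_4a6ca3c0.cov covR hx hx1 D1 lxd 14 probs05b = true := by
  decide +kernel

/-- Pointwise form. -/
theorem probs05b_all : ∀ x ∈ probs05b, probOK A1s_n192_k8_4a6ca3c0.cov covR hx hx1 D1 lxd 14 x = true := by
  have h := probs05b_ok
  rwa [probsOK, List.all_eq_true] at h

end Summit.Ventures.QEC.Census.A1s_n192_k8_4a6ca3c0
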